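import Literature.Analysis.FluidPDE.CheskidovShvydkoyReduction
import Literature.Analysis.FluidPDE.NSSerrinRegularityTao
import Literature.Analysis.FluidPDE.CheskidovShvydkoyAssembly
import Literature.Analysis.FluidPDE.TaoEnstrophyLocalisationLeaves
import HarnessLib

/-!
# Cheskidov–Shvydkoy's Lemma 3.2 in house form: the trust base

Analysis/FluidPDE proofs file (pure proofs: no definitions, no named facts), sibling of
`Literature/Analysis/FluidPDE/CheskidovShvydkoy.lean`, serving the discharge of the named fact
`Literature.Analysis.FluidPDE.cheskidov_shvydkoy_dyadic` — Cheskidov–Shvydkoy, Arch. Ration.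
Mech. Anal. 195 (2010), **Lemma 3.2** (p. 5 of arXiv:0708.3067: "Let `u(t)` be a Leray–Hopf
solution of (NSE) on `[0,T]`. There is a constant `c > 0` such that if
`limsup_{q → ∞} sup_{t ∈ (0,T)} λ_q⁻¹ ‖u_q(t)‖_∞ < cν`, then `u(t)` is regular on `(0,T]`"),
rendered with "regular on `(0, T]`" in the house form of ns.S07 (a classical representative on
the time set `Ioc 0 T`).

## Status of the discharge and what this file records

The accepted `cheskidov_shvydkoy_dyadic_of_regular` (`CheskidovShvydkoyReduction.lean`) reduces
the fact to two named facts of the tree: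

* `cheskidov_shvydkoy_dyadic_regular` (`CheskidovShvydkoyRegular.lean`) — Lemma 3.2 with the
  paper's own conclusion (p. 4: "regular" = `‖u(t)‖_{H¹}` continuous on `(0, T]`), i.e. the
  frequency-localised energy estimate of pp. 5–6 (its smooth-slab `H¹` form is proved in
  `CheskidovShvydkoyApriori.lean`) followed by Leray's continuation theorem (CS Thm. 2.4);
* `ladyzhenskaya_prodi_serrin` (ns.S07, `NSLerayHopf.lean`) — the smoothing of `H¹`-regular
  Leray–Hopf solutions, which the tree proves from Tao's local `H¹` theory alone
  (`ladyzhenskaya_prodi_serrin_of_tao`, `NSSerrinRegularityTao.lean`), as it does Leray's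
  continuation theorem (`leray_continuation_H1_of_tao`).

Composing, the trust base of `cheskidov_shvydkoy_dyadic` — and of Cor. 3.3
(`cheskidov_shvydkoy_small`), of Thm. 3.1 as printed (`cheskidov_shvydkoy_inhom`) and of the
accepted ns.S31 (`cheskidov_shvydkoy`) — is the pair
{`cheskidov_shvydkoy_dyadic_regular`, `tao2011_H1_local_almost_regular`}:

* `cheskidov_shvydkoy_dyadic_of_tao`, `cheskidov_shvydkoy_small_of_tao`,
  `cheskidov_shvydkoy_inhom_of_tao`, `cheskidov_shvydkoy_of_tao`.

Hence `cheskidov_shvydkoy_dyadic_holds` is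
`cheskidov_shvydkoy_dyadic_of_tao cheskidov_shvydkoy_dyadic_regular_holds
tao2011_H1_local_almost_regular_holds` as soon as those two discharges exist; neither fact is
restated or assumed here (D-0026), and nothing in this file is conditional on anything else.

## Addendum: the single leaf `leray_local_regular_H1`

With `CheskidovShvydkoyAssembly.lean` (Lemma 3.2 as printed from Leray's local regular solutions
issued from `H¹` data: `cheskidov_shvydkoy_dyadic_regular_of_local_regular`; Leray 1934,
§§19–24 = Ożański–Pooley 2018, Thm. 6.30 + Cor. 6.16, the named fact `leray_local_regular_H1` of
`LerayLocalRegularH1.lean`) and `TaoEnstrophyLocalisationLeaves.lean` (Tao's almost regular local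
`H¹` theory from the same fact: `tao2011_H1_local_almost_regular_of_leray`), both hypotheses of
the `_of_tao` theorems follow from `leray_local_regular_H1` alone. The three facts of
`CheskidovShvydkoy.lean` — Thm. 3.1 as printed (`cheskidov_shvydkoy_inhom`), Lemma 3.2 in house
form (`cheskidov_shvydkoy_dyadic`) and Cor. 3.3 (`cheskidov_shvydkoy_small`) — are thereby one
application away from `leray_local_regular_H1_holds`
(`cheskidov_shvydkoy_inhom_of_leray_local_regular_H1`,
`cheskidov_shvydkoy_dyadic_of_leray_local_regular_H1`,
`cheskidov_shvydkoy_small_of_leray_local_regular_H1`; the homogeneous ns.S31 has the accepted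
`cheskidov_shvydkoy_of_leray_local_regular_H1` of `CheskidovShvydkoyAssembly.lean`). Nothing is
assumed or restated; the trust base of each theorem is exactly its displayed hypothesis. (The
converse bridge `tao2011_H1_local_almost_regular → leray_local_regular_H1` is not in the tree: it
would need the gradient-only lifespan through the parabolic rescaling `u₀ ↦ λu₀(λ·)` of
Leray–Hopf solutions — the named fact `IsLerayHopfOn.nsRescale` of `SelfSimilar.lean` — and one
global classical representative glued from the slab representatives,
`exists_classical_Ioc_of_local`; it is not attempted here.)

## References

* A. Cheskidov, R. Shvydkoy, *The regularity of weak solutions of the 3D Navier–Stokes equations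
  in `B^{-1}_{∞,∞}`*, Arch. Ration. Mech. Anal. 195 (2010) 159–169 = arXiv:0708.3067: Thm. 2.4
  (p. 4), Thm. 3.1 and Lemma 3.2 with its proof (pp. 5–6), Cor. 3.3 and the proof of Thm. 3.1
  (p. 6). [CheskidovShvydkoy2010]
* T. Tao, *Localisation and compactness properties of the Navier–Stokes global regularity
  problem*, Anal. PDE 6 (2013) 25–107 = arXiv:1108.1165, Thm. 5.4 (i)–(ii), Prop. 5.6. [Tao2011]
* J. C. Robinson, J. L. Rodrigo, W. Sadowski, *The Three-Dimensional Navier–Stokes Equations.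
  Classical theory*, CUP 2016, Thm. 8.17 (Serrin class ⇒ smooth on `(0, T]`).
  [RobinsonRodrigoSadowski2016]
-/

namespace Literature.Analysis.FluidPDE

/-- **Cheskidov–Shvydkoy's Lemma 3.2 in house form from Lemma 3.2 as printed and Tao's local
`H¹` theory** (same constant `c`): the printed conclusion "`u` regular on `(0, T]`"
(`cheskidov_shvydkoy_dyadic_regular`: `‖u(t)‖_{H¹}` continuous on `(0, T]`) is upgraded to a
classical representative on `Ioc 0 T` by ns.S07, itself a consequence of
`tao2011_H1_local_almost_regular` (`ladyzhenskaya_prodi_serrin_of_tao`; Robinson–Rodrigo–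
Sadowski 2016, Thm. 8.17). Composition of the accepted `cheskidov_shvydkoy_dyadic_of_regular`
with `ladyzhenskaya_prodi_serrin_of_tao`. [cite: CheskidovShvydkoy2010, Lemma 3.2] -/
theorem cheskidov_shvydkoy_dyadic_of_tao (h32 : cheskidov_shvydkoy_dyadic_regular)
    (hT : tao2011_H1_local_almost_regular) : cheskidov_shvydkoy_dyadic :=
  cheskidov_shvydkoy_dyadic_of_regular h32 (ladyzhenskaya_prodi_serrin_of_tao hT)

/-- **Cheskidov–Shvydkoy's Cor. 3.3 from Lemma 3.2 as printed and Tao's local `H¹` theory**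
(p. 6: "this lemma immediately yields the following corollary" — the `L^∞_t B^{-1}_{∞,∞}` norm
dominates the dyadic quantity of Lemma 3.2, `cheskidov_shvydkoy_small_of_dyadic`).
[cite: CheskidovShvydkoy2010, Cor. 3.3] -/
theorem cheskidov_shvydkoy_small_of_tao (h32 : cheskidov_shvydkoy_dyadic_regular)
    (hT : tao2011_H1_local_almost_regular) : cheskidov_shvydkoy_small :=
  cheskidov_shvydkoy_small_of_dyadic (cheskidov_shvydkoy_dyadic_of_tao h32 hT)

/-- **Cheskidov–Shvydkoy's Thm. 3.1 as printed (inhomogeneous `B^{-1}_{∞,∞}` jumps,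
`cheskidov_shvydkoy_inhom`) from Lemma 3.2 as printed and Tao's local `H¹` theory**, with
constant `c/2` if Lemma 3.2 holds with `c` (proof of Thm. 3.1, p. 6): the accepted
`cheskidov_shvydkoy_inhom_of_regular` with both of its remaining inputs — Leray's continuation
theorem (CS Thm. 2.4, `s = 1`) and ns.S07 — taken from Tao's fact
(`leray_continuation_H1_of_tao`, `ladyzhenskaya_prodi_serrin_of_tao`).
[cite: CheskidovShvydkoy2010, Thm. 3.1 (proof, p. 6)] -/
theorem cheskidov_shvydkoy_inhom_of_tao (h32 : cheskidov_shvydkoy_dyadic_regular)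
    (hT : tao2011_H1_local_almost_regular) : cheskidov_shvydkoy_inhom :=
  cheskidov_shvydkoy_inhom_of_regular h32 (leray_continuation_H1_of_tao hT)
    (ladyzhenskaya_prodi_serrin_of_tao hT)

/-- **The accepted ns.S31 (`cheskidov_shvydkoy`, homogeneous `Ḃ^{-1}_{∞,∞}` jumps) from Lemma 3.2
as printed and Tao's local `H¹` theory**: `cheskidov_shvydkoy_of_regular` with Leray's
continuation theorem and ns.S07 taken from Tao's fact. The trust base of ns.S31 is thereby
{`cheskidov_shvydkoy_dyadic_regular`, `tao2011_H1_local_almost_regular`}.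
[cite: CheskidovShvydkoy2010, Thm. 3.1] -/
theorem cheskidov_shvydkoy_of_tao (h32 : cheskidov_shvydkoy_dyadic_regular)
    (hT : tao2011_H1_local_almost_regular) : cheskidov_shvydkoy :=
  cheskidov_shvydkoy_of_regular h32 (leray_continuation_H1_of_tao hT)
    (ladyzhenskaya_prodi_serrin_of_tao hT)

/-- **Thm. 3.1 as printed from Leray's local regular `H¹` solutions alone.** Cheskidov–Shvydkoy's
`B^{-1}_{∞,∞}`-jump criterion in its printed (inhomogeneous) form, `cheskidov_shvydkoy_inhom`,
follows from the single named fact `leray_local_regular_H1` (Leray 1934, §§19–24; Ożański–Pooley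
2018, Thm. 6.30 + Cor. 6.16): Lemma 3.2 as printed is
`cheskidov_shvydkoy_dyadic_regular_of_local_regular`, Tao's almost regular local `H¹` theory
(whence Thm. 2.4 and ns.S07) is `tao2011_H1_local_almost_regular_of_leray`, and
`cheskidov_shvydkoy_inhom_of_tao` assembles the printed proof of Thm. 3.1 (p. 6). The discharge
`cheskidov_shvydkoy_inhom_holds` is this theorem applied to `leray_local_regular_H1_holds`.
[cite: CheskidovShvydkoy2010, Thm. 3.1 (proof, p. 6)] -/
theorem cheskidov_shvydkoy_inhom_of_leray_local_regular_H1 (h : leray_local_regular_H1) :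
    cheskidov_shvydkoy_inhom :=
  cheskidov_shvydkoy_inhom_of_tao (cheskidov_shvydkoy_dyadic_regular_of_local_regular h)
    (tao2011_H1_local_almost_regular_of_leray h)

/-- **Lemma 3.2 in house form from Leray's local regular `H¹` solutions alone**:
`cheskidov_shvydkoy_dyadic` from `leray_local_regular_H1`, through
`cheskidov_shvydkoy_dyadic_regular_of_local_regular`, `tao2011_H1_local_almost_regular_of_leray`
and `cheskidov_shvydkoy_dyadic_of_tao`. [cite: CheskidovShvydkoy2010, Lemma 3.2] -/
theorem cheskidov_shvydkoy_dyadic_of_leray_local_regular_H1 (h : leray_local_regular_H1) :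
    cheskidov_shvydkoy_dyadic :=
  cheskidov_shvydkoy_dyadic_of_tao (cheskidov_shvydkoy_dyadic_regular_of_local_regular h)
    (tao2011_H1_local_almost_regular_of_leray h)

/-- **Cor. 3.3 from Leray's local regular `H¹` solutions alone**: `cheskidov_shvydkoy_small`
from `leray_local_regular_H1`, through `cheskidov_shvydkoy_small_of_dyadic` and
`cheskidov_shvydkoy_dyadic_of_leray_local_regular_H1` (p. 6: "this lemma immediately yields the
following corollary"). [cite: CheskidovShvydkoy2010, Cor. 3.3] -/
theorem cheskidov_shvydkoy_small_of_leray_local_regular_H1 (h : leray_local_regular_H1) :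
    cheskidov_shvydkoy_small :=
  cheskidov_shvydkoy_small_of_dyadic (cheskidov_shvydkoy_dyadic_of_leray_local_regular_H1 h)

end Literature.Analysis.FluidPDE
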